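import Mathlib
import HarnessLib
import Summits.Parity.BatemanHorn.Theses.AlmostPrimeZeros
import Summits.Parity.BatemanHorn.Theorems.AlmostPrimeZerosDeficitFromRepulsion
import Summits.Parity.BatemanHorn.Theorems.AlmostPrimeZerosSystemMomentDeficitOfDiscMajorantLog

/-!
# Crux `SystemMomentDeficit` (stmt-Parity-11326): the deficit is the curvature of `‖S_x‖²` in the
# imaginary direction, and the edge `VerticalSubGaussian → SystemMomentDeficit`

Route `AlmostPrimeZeros`, crux
`Summit.Parity.BatemanHorn.Theses.AlmostPrimeZeros.SystemMomentDeficit` (rank 4): for every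
Bateman–Horn system `f`, the factorial-moment deficit `m₁(x) − v(x)` of the capped statistic
`s_f(n) = Σ_i Σ_{p^v ∥ f_i(n)} min(v, 2)` is bounded above for `x ≥ 2`.  Line `Sketch` (idea
`small-circle-jensen`), lead c6.  Everything in this file is sorry-free and definition-free.

For an exponent sequence `e : ℕ → ℕ` and `x`, let `S(z) = Σ_{0 ≤ n ≤ x} z^{e n}` (the almost-prime
polynomial when `e = s_f`), `N = x + 1 = S(1)`, `m₁ = N⁻¹ Σ e`, `v = N⁻¹ Σ e² − m₁²`.

* `hasDerivAt_sum_one_add_mul_pow`, `hasDerivAt_sum_mul_one_add_mul_pow` — derivatives of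
  `w ↦ Σ_n (1 + cw)^{e n}` and of its derivative (`c = ±I` gives `S(1 ± iw)`).
* `norm_sq_vertical_eq_re` — `‖S(1+iy)‖² = Re[S(1+iy)·S(1−iy)]` for real `y` (real coefficients).
* `hasDerivAt_normSq_vertical`, `hasDerivAt_deriv_normSq_vertical_zero` — **the identity**:
  `y ↦ ‖S(1+iy)‖²` has derivative `0` at `y = 0` and second derivative
  `2[(Σ e)² − N·(Σ e² − Σ e)] = 2N²(m₁ − v)` there.  So the deficit is the curvature of
  `‖S_x‖²/(2N²)` in the IMAGINARY direction at `z = 1` — where every real tilt `e^{−a(z−1)}` has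
  modulus `1`.  (Vertical-line companion of the tree identity `Σ_ρ (1−ρ)⁻² = m₁ − v`,
  `Summit.Parity.BatemanHorn.Theorems.sum_inv_one_sub_sq_roots_eq`.)
* `le_of_hasDerivAt_two_of_le` — second-derivative comparison at a touching point (real analysis):
  `q ≤ G` on `(0, y₀]`, `q 0 = G 0`, `q' 0 = G' 0 = 0` ⟹ `q''(0) ≤ G''(0)`.
* `deficit_le_of_verticalBound` — **per statistic**: a PINCHED sub-Gaussian bound on a vertical
  segment, `‖S(1+iy)‖ ≤ N·e^{C y²}` for `0 < y ≤ y₀`, gives `m₁ − v ≤ 2C`.  No Jensen formula, no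
  Poisson–Jensen inequality, no Borel–Carathéodory, no tilt: only upper bounds for `‖S‖` on one
  segment transversal to the real axis at `1`, used one-sidedly.
* `systemMomentDeficit_of_verticalSubGaussian` — **the edge** `VerticalSubGaussian → SystemMomentDeficit`
  BY NAME, where `VerticalSubGaussian` (hypothesis shape; the line's reshaped registered stub
  `stub_verticalSubGaussian`) says: for every Bateman–Horn system there are `C`, `y₀ > 0`, `x₀`
  with `‖Σ_{n ≤ x} (1+iy)^{s_f(n)}‖ ≤ (x+1)e^{C y²}` for all `x ≥ x₀`, `0 < y ≤ y₀`.

Why this is the right analytic intermediate for rank 4: `‖S_x(1+iy)‖/(x+1) = |E_x (1+iy)^{s_f}|`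
is the characteristic function of `s_f` at frequency `arctan y`, tilted by `(1+y²)^{s_f/2}`; the
hypothesis is Gaussian decay of that characteristic function to the full depth `e^{−Var·y²/2}` (in
the Poisson model `E z^s = e^{λ(z−1)}` it holds with `C = 0` for ALL `y`).  It is implied by K1
(`stub_smallCircleJensen`): Jensen gives a zero-free disc, Poisson–Jensen and Borel–Carathéodory give
`|log H| = O(A)` on a smaller disc, and `Re[(log H)'(1)·iy] = 0` because `(log H)'(1) = m₁ − a` is
REAL, so `log(‖S(1+iy)‖/N) = Re log H(1+iy) = O(A y²/r²)` by the Schwarz lemma — hence also by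
rank 8 and rank 2 through the landed edges.  Unlike K1 it is one-sided: it bounds `m₁ − v` from
above only, and it holds (with room) for the reducible non-systems `(X²)`, `(X, X)` on which the
two-sided bound `|m₁ − v| ≤ C` fails (Disproof §8–9).  It is OPEN for every system with
`Σ deg f_i ≥ 2` for the same reason as K1 (anatomy classes: `S_x(1+iy) = Σ_b (1+iy)^b T_b(1+iy)`
needs Poisson-rate cancellation on rough and smooth values separately — the universality input (U)
of `Cruxes/SystemMomentDeficit/NOTES.md` at characteristic-function level).

References: idea card `Cruxes/SystemMomentDeficit/Ideas/small-circle-jensen.md`; G. Tenenbaum,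
*Introduction to analytic and probabilistic number theory*, II.5–II.6 and III.4.
-/

noncomputable section

namespace Summit.Parity.BatemanHorn.Cruxes.SystemMomentDeficit.SmallCircle

open scoped BigOperators Nat ComplexConjugate
open Complex Filter Set

/-! ### Derivatives along the line `w ↦ 1 + c·w` -/

/-- `w ↦ 1 + w·c` has derivative `c`. -/
theorem hasDerivAt_one_add_mul (c w : ℂ) : HasDerivAt (fun w : ℂ => 1 + w * c) c w := by
  simpa using ((hasDerivAt_id w).mul_const c).const_add 1

/-- Derivative of `w ↦ Σ_n (1 + w c)^{e n}`. -/
theorem hasDerivAt_sum_one_add_mul_pow (e : ℕ → ℕ) (x : ℕ) (c w : ℂ) :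
    HasDerivAt (fun w : ℂ => ∑ n ∈ Finset.range (x + 1), (1 + w * c) ^ (e n))
      (∑ n ∈ Finset.range (x + 1), (e n : ℂ) * (1 + w * c) ^ (e n - 1) * c) w := by
  apply HasDerivAt.fun_sum
  intro n _
  exact (hasDerivAt_one_add_mul c w).fun_pow (e n)

/-- Derivative of `w ↦ Σ_n (e n)(1 + w c)^{e n − 1} c`. -/
theorem hasDerivAt_sum_mul_one_add_mul_pow (e : ℕ → ℕ) (x : ℕ) (c w : ℂ) :
    HasDerivAt (fun w : ℂ => ∑ n ∈ Finset.range (x + 1), (e n : ℂ) * (1 + w * c) ^ (e n - 1) * c)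
      (∑ n ∈ Finset.range (x + 1),
        (e n : ℂ) * (((e n - 1 : ℕ) : ℂ) * (1 + w * c) ^ (e n - 1 - 1) * c) * c) w := by
  apply HasDerivAt.fun_sum
  intro n _
  exact (((hasDerivAt_one_add_mul c w).fun_pow (e n - 1)).const_mul (e n : ℂ)).mul_const c

/-- Value at `w = 0` of the second-derivative sum: `(Σ_n ((e n)² − e n))·c²`. -/
theorem sum_mul_pred_mul_sq_zero (e : ℕ → ℕ) (x : ℕ) (c : ℂ) :
    (∑ n ∈ Finset.range (x + 1),
        (e n : ℂ) * (((e n - 1 : ℕ) : ℂ) * (1 + (0 : ℂ) * c) ^ (e n - 1 - 1) * c) * c) =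
      (∑ n ∈ Finset.range (x + 1), ((e n : ℂ) ^ 2 - e n)) * (c * c) := by
  rw [Finset.sum_mul]
  refine Finset.sum_congr rfl fun n _ => ?_
  rw [← Summit.Parity.BatemanHorn.Theorems.natCast_mul_natCast_sub_one]
  simp only [zero_mul, add_zero, one_pow, mul_one]
  ring

/-! ### `‖S(1+iy)‖²` as the real part of `S(1+iy)·S(1−iy)` -/

/-- For real `y`, `Σ_n (1 − iy)^{e n}` is the conjugate of `Σ_n (1 + iy)^{e n}`. -/
theorem sum_one_sub_pow_eq_conj (e : ℕ → ℕ) (x : ℕ) (y : ℝ) :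
    (∑ n ∈ Finset.range (x + 1), (1 + (y : ℂ) * (-I)) ^ (e n)) =
      conj (∑ n ∈ Finset.range (x + 1), (1 + (y : ℂ) * I) ^ (e n)) := by
  simp only [map_sum, map_pow, map_add, map_one, map_mul, Complex.conj_ofReal, Complex.conj_I]

/-- `‖S(1+iy)‖² = Re[S(1+iy) · S(1−iy)]` for real `y`. -/
theorem norm_sq_vertical_eq_re (e : ℕ → ℕ) (x : ℕ) (y : ℝ) :
    ‖∑ n ∈ Finset.range (x + 1), (1 + (y : ℂ) * I) ^ (e n)‖ ^ 2 =
      ((∑ n ∈ Finset.range (x + 1), (1 + (y : ℂ) * I) ^ (e n)) *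
        (∑ n ∈ Finset.range (x + 1), (1 + (y : ℂ) * (-I)) ^ (e n))).re := by
  rw [sum_one_sub_pow_eq_conj, Complex.mul_conj, Complex.ofReal_re, Complex.normSq_eq_norm_sq]

/-! ### The identity: first and second derivative of `y ↦ ‖S(1+iy)‖²` at `0` -/

/-- `y ↦ ‖S(1+iy)‖²` is differentiable, with derivative the real part of
`S₁(1+iy)·S(1−iy) + S(1+iy)·S₁⁻(1−iy)` (product rule for `S(1+iw)S(1−iw)` restricted to real `w`). -/
theorem hasDerivAt_normSq_vertical (e : ℕ → ℕ) (x : ℕ) (y : ℝ) :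
    HasDerivAt (fun y : ℝ => ‖∑ n ∈ Finset.range (x + 1), (1 + (y : ℂ) * I) ^ (e n)‖ ^ 2)
      ((∑ n ∈ Finset.range (x + 1), (e n : ℂ) * (1 + (y : ℂ) * I) ^ (e n - 1) * I) *
          (∑ n ∈ Finset.range (x + 1), (1 + (y : ℂ) * (-I)) ^ (e n)) +
        (∑ n ∈ Finset.range (x + 1), (1 + (y : ℂ) * I) ^ (e n)) *
          (∑ n ∈ Finset.range (x + 1), (e n : ℂ) * (1 + (y : ℂ) * (-I)) ^ (e n - 1) * (-I))).re y := by
  have h := ((hasDerivAt_sum_one_add_mul_pow e x I (y : ℂ)).fun_mul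
    (hasDerivAt_sum_one_add_mul_pow e x (-I) (y : ℂ))).real_of_complex
  have hfun : (fun y : ℝ => ((∑ n ∈ Finset.range (x + 1), (1 + (y : ℂ) * I) ^ (e n)) *
      (∑ n ∈ Finset.range (x + 1), (1 + (y : ℂ) * (-I)) ^ (e n))).re) =
      fun y : ℝ => ‖∑ n ∈ Finset.range (x + 1), (1 + (y : ℂ) * I) ^ (e n)‖ ^ 2 := by
    funext y
    rw [norm_sq_vertical_eq_re]
  rw [hfun] at h
  exact h

/-- The first derivative of `y ↦ ‖S(1+iy)‖²` vanishes at `y = 0`. -/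
theorem deriv_normSq_vertical_zero (e : ℕ → ℕ) (x : ℕ) :
    ((∑ n ∈ Finset.range (x + 1), (e n : ℂ) * (1 + (((0 : ℝ) : ℂ)) * I) ^ (e n - 1) * I) *
          (∑ n ∈ Finset.range (x + 1), (1 + (((0 : ℝ) : ℂ)) * (-I)) ^ (e n)) +
        (∑ n ∈ Finset.range (x + 1), (1 + (((0 : ℝ) : ℂ)) * I) ^ (e n)) *
          (∑ n ∈ Finset.range (x + 1), (e n : ℂ) * (1 + (((0 : ℝ) : ℂ)) * (-I)) ^ (e n - 1) * (-I))).re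
      = 0 := by
  have hs' : (∑ n ∈ Finset.range (x + 1), (e n : ℂ) * (1 + (((0 : ℝ) : ℂ)) * I) ^ (e n - 1) * I) =
      (∑ n ∈ Finset.range (x + 1), (e n : ℂ)) * I := by
    rw [Finset.sum_mul]
    refine Finset.sum_congr rfl fun n _ => ?_
    simp
  have hs'' : (∑ n ∈ Finset.range (x + 1), (e n : ℂ) * (1 + (((0 : ℝ) : ℂ)) * (-I)) ^ (e n - 1) * (-I)) =
      -((∑ n ∈ Finset.range (x + 1), (e n : ℂ)) * I) := by
    rw [Finset.sum_mul, ← Finset.sum_neg_distrib]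
    refine Finset.sum_congr rfl fun n _ => ?_
    simp
  have hT : (∑ n ∈ Finset.range (x + 1), (1 + (((0 : ℝ) : ℂ)) * I) ^ (e n)) = (x : ℂ) + 1 := by
    simp
  have hU : (∑ n ∈ Finset.range (x + 1), (1 + (((0 : ℝ) : ℂ)) * (-I)) ^ (e n)) = (x : ℂ) + 1 := by
    simp
  rw [hs', hs'', hT, hU]
  have hzero : (∑ n ∈ Finset.range (x + 1), (e n : ℂ)) * I * ((x : ℂ) + 1) +
      ((x : ℂ) + 1) * -((∑ n ∈ Finset.range (x + 1), (e n : ℂ)) * I) = 0 := by ring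
  rw [hzero, Complex.zero_re]

/-- **The identity.**  The second derivative of `y ↦ ‖S(1+iy)‖²` at `y = 0` is
`2[(Σ e)² − N(Σ e² − Σ e)] = 2N²(m₁ − v)`. -/
theorem hasDerivAt_deriv_normSq_vertical_zero (e : ℕ → ℕ) (x : ℕ) :
    HasDerivAt (fun y : ℝ =>
      ((∑ n ∈ Finset.range (x + 1), (e n : ℂ) * (1 + (y : ℂ) * I) ^ (e n - 1) * I) *
          (∑ n ∈ Finset.range (x + 1), (1 + (y : ℂ) * (-I)) ^ (e n)) +
        (∑ n ∈ Finset.range (x + 1), (1 + (y : ℂ) * I) ^ (e n)) *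
          (∑ n ∈ Finset.range (x + 1), (e n : ℂ) * (1 + (y : ℂ) * (-I)) ^ (e n - 1) * (-I))).re)
      (2 * (((∑ n ∈ Finset.range (x + 1), e n : ℕ) : ℝ) ^ 2 -
        ((x : ℝ) + 1) * (((∑ n ∈ Finset.range (x + 1), (e n) ^ 2 : ℕ) : ℝ) -
          ((∑ n ∈ Finset.range (x + 1), e n : ℕ) : ℝ)))) 0 := by
  have hT := hasDerivAt_sum_one_add_mul_pow e x I ((0 : ℝ) : ℂ)
  have hU := hasDerivAt_sum_one_add_mul_pow e x (-I) ((0 : ℝ) : ℂ)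
  have hT₁ := hasDerivAt_sum_mul_one_add_mul_pow e x I ((0 : ℝ) : ℂ)
  have hU₁ := hasDerivAt_sum_mul_one_add_mul_pow e x (-I) ((0 : ℝ) : ℂ)
  have h := ((hT₁.fun_mul hU).fun_add (hT.fun_mul hU₁)).real_of_complex
  refine h.congr_deriv ?_
  rw [Complex.ofReal_zero, sum_mul_pred_mul_sq_zero, sum_mul_pred_mul_sq_zero]
  have hs' : (∑ n ∈ Finset.range (x + 1), (e n : ℂ) * (1 + (0 : ℂ) * I) ^ (e n - 1) * I) =
      (∑ n ∈ Finset.range (x + 1), (e n : ℂ)) * I := by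
    rw [Finset.sum_mul]
    refine Finset.sum_congr rfl fun n _ => ?_
    simp
  have hs'' : (∑ n ∈ Finset.range (x + 1), (e n : ℂ) * (1 + (0 : ℂ) * (-I)) ^ (e n - 1) * (-I)) =
      -((∑ n ∈ Finset.range (x + 1), (e n : ℂ)) * I) := by
    rw [Finset.sum_mul, ← Finset.sum_neg_distrib]
    refine Finset.sum_congr rfl fun n _ => ?_
    simp
  have hTv : (∑ n ∈ Finset.range (x + 1), (1 + (0 : ℂ) * I) ^ (e n)) = (x : ℂ) + 1 := by simp
  have hUv : (∑ n ∈ Finset.range (x + 1), (1 + (0 : ℂ) * (-I)) ^ (e n)) = (x : ℂ) + 1 := by simp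
  rw [hs', hs'', hTv, hUv]
  have hsum : (∑ n ∈ Finset.range (x + 1), ((e n : ℂ) ^ 2 - e n)) =
      (((∑ n ∈ Finset.range (x + 1), (e n) ^ 2 : ℕ) : ℝ) : ℂ) -
        (((∑ n ∈ Finset.range (x + 1), e n : ℕ) : ℝ) : ℂ) := by
    rw [Finset.sum_sub_distrib]
    push_cast
    rfl
  have hs : (∑ n ∈ Finset.range (x + 1), (e n : ℂ)) =
      (((∑ n ∈ Finset.range (x + 1), e n : ℕ) : ℝ) : ℂ) := by
    push_cast; rfl
  have hx : ((x : ℂ) + 1) = (((x : ℝ) + 1 : ℝ) : ℂ) := by push_cast; rfl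
  rw [hsum, hs, hx]
  have hI : I * I = -1 := I_mul_I
  have hre : (((((∑ n ∈ Finset.range (x + 1), (e n) ^ 2 : ℕ) : ℝ) : ℂ) -
        (((∑ n ∈ Finset.range (x + 1), e n : ℕ) : ℝ) : ℂ)) * (I * I) * (((x : ℝ) + 1 : ℝ) : ℂ) +
        (((∑ n ∈ Finset.range (x + 1), e n : ℕ) : ℝ) : ℂ) * I *
          -((((∑ n ∈ Finset.range (x + 1), e n : ℕ) : ℝ) : ℂ) * I) +
      ((((∑ n ∈ Finset.range (x + 1), e n : ℕ) : ℝ) : ℂ) * I *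
          -((((∑ n ∈ Finset.range (x + 1), e n : ℕ) : ℝ) : ℂ) * I) +
        (((x : ℝ) + 1 : ℝ) : ℂ) * (((((∑ n ∈ Finset.range (x + 1), (e n) ^ 2 : ℕ) : ℝ) : ℂ) -
          (((∑ n ∈ Finset.range (x + 1), e n : ℕ) : ℝ) : ℂ)) * (-I * -I))))
      = (((2 * (((∑ n ∈ Finset.range (x + 1), e n : ℕ) : ℝ) ^ 2 -
        ((x : ℝ) + 1) * (((∑ n ∈ Finset.range (x + 1), (e n) ^ 2 : ℕ) : ℝ) -
          ((∑ n ∈ Finset.range (x + 1), e n : ℕ) : ℝ))) : ℝ) : ℂ)) := by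
    simp only [Complex.ofReal_mul, Complex.ofReal_sub, Complex.ofReal_pow, Complex.ofReal_ofNat]
    linear_combination (2 * ((((∑ n ∈ Finset.range (x + 1), (e n) ^ 2 : ℕ) : ℝ) : ℂ) -
      (((∑ n ∈ Finset.range (x + 1), e n : ℕ) : ℝ) : ℂ)) * (((x : ℝ) + 1 : ℝ) : ℂ) -
      2 * (((∑ n ∈ Finset.range (x + 1), e n : ℕ) : ℝ) : ℂ) ^ 2) * hI
  rw [hre, Complex.ofReal_re]

/-! ### Second-derivative comparison at a touching point -/

/-- **Second-order comparison.**  If `q ≤ G` on `(0, y₀]`, `q 0 = G 0`, both are differentiable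
with `q' 0 = G' 0 = 0`, and `q'`, `G'` are differentiable at `0` with derivatives `L`, `M`, then
`L ≤ M`.  (If `L > M`, the slope `(G' − q')(y)/y → M − L < 0` makes `G − q` strictly decreasing
just to the right of `0`, contradicting `G − q ≥ 0 = (G − q)(0)` by the mean value theorem.) -/
theorem le_of_hasDerivAt_two_of_le {q q' G G' : ℝ → ℝ} {L M y₀ : ℝ} (hy₀ : 0 < y₀)
    (hq : ∀ y, HasDerivAt q (q' y) y) (hG : ∀ y, HasDerivAt G (G' y) y)
    (hq0 : q' 0 = 0) (hG0 : G' 0 = 0) (hqL : HasDerivAt q' L 0) (hGM : HasDerivAt G' M 0)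
    (h0 : q 0 = G 0) (hle : ∀ y, 0 < y → y ≤ y₀ → q y ≤ G y) : L ≤ M := by
  by_contra hLM
  push Not at hLM
  have hg : ∀ y, HasDerivAt (fun y => G y - q y) (G' y - q' y) y := fun y => (hG y).sub (hq y)
  have hg' : HasDerivAt (fun y => G' y - q' y) (M - L) 0 := hGM.sub hqL
  have hneg : M - L < 0 := by linarith
  have ht : Tendsto (slope (fun y => G' y - q' y) 0) (nhdsWithin 0 {0}ᶜ) (nhds (M - L)) :=
    hasDerivAt_iff_tendsto_slope.1 hg'
  have hev : ∀ᶠ y in nhdsWithin (0 : ℝ) {0}ᶜ, slope (fun y => G' y - q' y) 0 y < 0 :=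
    ht (Iio_mem_nhds hneg)
  rw [eventually_nhdsWithin_iff, Metric.eventually_nhds_iff] at hev
  obtain ⟨δ, hδ, hδ'⟩ := hev
  set y₁ : ℝ := min δ y₀ / 2 with hy₁
  have hy₁pos : 0 < y₁ := by positivity
  have hy₁δ : y₁ < δ := by
    have : min δ y₀ ≤ δ := min_le_left _ _
    rw [hy₁]; linarith
  have hy₁y₀ : y₁ ≤ y₀ := by
    have : min δ y₀ ≤ y₀ := min_le_right _ _
    rw [hy₁]; linarith [le_min hδ.le hy₀.le]
  have hg'neg : ∀ y, 0 < y → y < δ → G' y - q' y < 0 := by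
    intro y hy hyδ
    have hmem : dist y 0 < δ := by simpa [Real.dist_eq, abs_of_pos hy] using hyδ
    have hs := hδ' hmem (by simpa using hy.ne')
    rw [slope_def_field] at hs
    simp only [hG0, hq0, sub_zero] at hs
    by_contra hcon
    push Not at hcon
    have : 0 ≤ (G' y - q' y) / y := div_nonneg hcon hy.le
    linarith
  have hcont : ContinuousOn (fun y => G y - q y) (Icc 0 y₁) :=
    fun y _ => (hg y).continuousAt.continuousWithinAt
  obtain ⟨c, hc, hceq⟩ := exists_hasDerivAt_eq_slope (fun y => G y - q y) (fun y => G' y - q' y)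
    hy₁pos hcont (fun y _ => hg y)
  have hneg' := hg'neg c hc.1 (lt_trans hc.2 hy₁δ)
  rw [hceq] at hneg'
  have hnum : 0 ≤ (G y₁ - q y₁) - (G 0 - q 0) := by
    have := hle y₁ hy₁pos hy₁y₀
    rw [h0]; linarith
  have : 0 ≤ ((G y₁ - q y₁) - (G 0 - q 0)) / (y₁ - 0) := div_nonneg hnum (by linarith)
  linarith

/-! ### The deficit from a pinched sub-Gaussian bound on a vertical segment -/

/-- **Per statistic.**  If `‖S(1+iy)‖ ≤ (x+1)·e^{C y²}` for `0 < y ≤ y₀` (`S(z) = Σ_{n ≤ x} z^{e n}`),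
then `m₁ − v ≤ 2C`. -/
theorem deficit_le_of_verticalBound (e : ℕ → ℕ) (x : ℕ) (C y₀ : ℝ) (hy₀ : 0 < y₀)
    (hV : ∀ y : ℝ, 0 < y → y ≤ y₀ →
      ‖∑ n ∈ Finset.range (x + 1), (1 + (y : ℂ) * I) ^ (e n)‖ ≤ ((x : ℝ) + 1) * Real.exp (C * y ^ 2)) :
    ((∑ n ∈ Finset.range (x + 1), e n : ℕ) : ℝ) / ((x : ℝ) + 1) -
      ((((∑ n ∈ Finset.range (x + 1), (e n) ^ 2 : ℕ)) : ℝ) / ((x : ℝ) + 1) -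
        (((∑ n ∈ Finset.range (x + 1), e n : ℕ) : ℝ) / ((x : ℝ) + 1)) ^ 2) ≤ 2 * C := by
  set N : ℝ := (x : ℝ) + 1 with hN
  have hNpos : 0 < N := by rw [hN]; positivity
  set Se : ℝ := ((∑ n ∈ Finset.range (x + 1), e n : ℕ) : ℝ) with hSe
  set Se2 : ℝ := ((∑ n ∈ Finset.range (x + 1), (e n) ^ 2 : ℕ) : ℝ) with hSe2
  -- the comparison function G y = N² exp (2 C y²), G' y = N² (exp (2 C y²) (2C (2y)))
  set G : ℝ → ℝ := fun y => N ^ 2 * Real.exp (2 * C * y ^ 2) with hG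
  set G' : ℝ → ℝ := fun y => N ^ 2 * (Real.exp (2 * C * y ^ 2) * (2 * C * (2 * y))) with hG'
  have h1 : ∀ y : ℝ, HasDerivAt (fun y : ℝ => 2 * C * y ^ 2) (2 * C * (2 * y)) y := by
    intro y
    simpa using ((hasDerivAt_id y).fun_pow 2).const_mul (2 * C)
  have hGd : ∀ y, HasDerivAt G (G' y) y := fun y => ((h1 y).exp).const_mul (N ^ 2)
  have hG'0 : G' 0 = 0 := by simp [hG']
  have hG'd : HasDerivAt G' (N ^ 2 * (4 * C)) 0 := by
    have h2 : HasDerivAt (fun y : ℝ => 2 * C * (2 * y)) (2 * C * 2) 0 := by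
      simpa using ((hasDerivAt_id (0 : ℝ)).const_mul 2).const_mul (2 * C)
    have h3 := ((h1 0).exp.fun_mul h2).const_mul (N ^ 2)
    refine h3.congr_deriv ?_
    rw [show (2 : ℝ) * C * (0 : ℝ) ^ 2 = 0 by ring, Real.exp_zero]
    ring
  -- the function q y = ‖S(1+iy)‖² and its derivatives
  have hqd := hasDerivAt_normSq_vertical e x
  have hq'0 := deriv_normSq_vertical_zero e x
  have hq'd := hasDerivAt_deriv_normSq_vertical_zero e x
  have h0 : (fun y : ℝ => ‖∑ n ∈ Finset.range (x + 1), (1 + (y : ℂ) * I) ^ (e n)‖ ^ 2) 0 = G 0 := by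
    have hsum0 : (∑ n ∈ Finset.range (x + 1), (1 + (((0 : ℝ) : ℂ)) * I) ^ (e n)) = ((N : ℝ) : ℂ) := by
      rw [hN]; push_cast; simp
    show ‖∑ n ∈ Finset.range (x + 1), (1 + (((0 : ℝ) : ℂ)) * I) ^ (e n)‖ ^ 2 =
      N ^ 2 * Real.exp (2 * C * (0 : ℝ) ^ 2)
    rw [hsum0, Complex.norm_real, Real.norm_eq_abs, abs_of_pos hNpos,
      show (2 : ℝ) * C * (0 : ℝ) ^ 2 = 0 by ring, Real.exp_zero, mul_one]
  have hle : ∀ y, 0 < y → y ≤ y₀ →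
      (fun y : ℝ => ‖∑ n ∈ Finset.range (x + 1), (1 + (y : ℂ) * I) ^ (e n)‖ ^ 2) y ≤ G y := by
    intro y hy hyy
    have h := hV y hy hyy
    simp only [hG]
    have hnn : 0 ≤ ‖∑ n ∈ Finset.range (x + 1), (1 + (y : ℂ) * I) ^ (e n)‖ := norm_nonneg _
    calc ‖∑ n ∈ Finset.range (x + 1), (1 + (y : ℂ) * I) ^ (e n)‖ ^ 2
        ≤ (N * Real.exp (C * y ^ 2)) ^ 2 := by
          rw [hN]; exact pow_le_pow_left₀ hnn h 2
      _ = N ^ 2 * Real.exp (2 * C * y ^ 2) := by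
          rw [mul_pow, ← Real.exp_nat_mul]; ring_nf
  have key := le_of_hasDerivAt_two_of_le hy₀ hqd hGd hq'0 hG'0 hq'd hG'd h0 hle
  have hkey : Se ^ 2 - N * (Se2 - Se) ≤ N ^ 2 * (2 * C) := by
    rw [← hSe, ← hSe2, ← hN] at key; linarith
  have hgoal : Se / N - (Se2 / N - (Se / N) ^ 2) = (Se ^ 2 - N * (Se2 - Se)) / N ^ 2 := by
    field_simp
    ring
  rw [hgoal, div_le_iff₀ (by positivity)]
  linarith

/-- **The edge `VerticalSubGaussian → SystemMomentDeficit`** (the crux by name from a pinched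
sub-Gaussian bound for the almost-prime polynomial on a vertical segment through `z = 1`, for every
Bateman–Horn system; finitely many small `x` absorbed). -/
theorem systemMomentDeficit_of_verticalSubGaussian : (∀ (k : ℕ) (f : Fin k → Polynomial ℤ), Literature.NumberTheory.Sieve.IsBatemanHornSystem f → ∃ C y₀ : ℝ, ∃ x₀ : ℕ, 0 < y₀ ∧ ∀ x : ℕ, x₀ ≤ x → ∀ y : ℝ, 0 < y → y ≤ y₀ → ‖∑ n ∈ Finset.range (x + 1), (1 + (y : ℂ) * Complex.I) ^ (∑ i, (((f i).eval (n : ℤ)).toNat.factorization.sum fun _ v => min v 2))‖ ≤ ((x : ℝ) + 1) * Real.exp (C * y ^ 2)) → Summit.Parity.BatemanHorn.Theses.AlmostPrimeZeros.SystemMomentDeficit := by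
  intro hV
  unfold Summit.Parity.BatemanHorn.Theses.AlmostPrimeZeros.SystemMomentDeficit
  intro k f hf
  obtain ⟨C, y₀, x₀, hy₀, hb⟩ := hV k f hf
  set e : ℕ → ℕ := fun n => ∑ i, (((f i).eval (n : ℤ)).toNat.factorization.sum fun _ v => min v 2)
    with he
  obtain ⟨C', hC'⟩ := bddAbove_of_eventually (x₀ := x₀)
    (T := fun x : ℕ => ((∑ n ∈ Finset.range (x + 1), e n : ℕ) : ℝ) / ((x : ℝ) + 1) -
      ((((∑ n ∈ Finset.range (x + 1), (e n) ^ 2 : ℕ)) : ℝ) / ((x : ℝ) + 1) -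
        (((∑ n ∈ Finset.range (x + 1), e n : ℕ) : ℝ) / ((x : ℝ) + 1)) ^ 2))
    (B := 2 * C)
    (fun x hx => deficit_le_of_verticalBound e x C y₀ hy₀ (fun y hy hyy => hb x hx y hy hyy))
  exact ⟨C', fun x _ => hC' x⟩

end Summit.Parity.BatemanHorn.Cruxes.SystemMomentDeficit.SmallCircle

end
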